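import Mathlib.Analysis.Analytic.OfScalars
import Mathlib.Analysis.Analytic.ChangeOrigin
import Mathlib.Analysis.Calculus.SmoothSeries
import Mathlib.Analysis.Normed.Ring.InfiniteSum
import Mathlib.Analysis.SpecificLimits.Normed
import Mathlib.Analysis.Calculus.Deriv.Pow
import Mathlib.Combinatorics.Enumerative.Catalan.Basic
import Literature.Analysis.FluidPDE.CompressibleEulerImplosionMonatomicAlgebra
import HarnessLib

/-!
# Buckmaster–Cao-Labora–Gómez-Serrano at `γ = 5/3`: the Taylor series of the smooth profile at `P_s`

Topic `Literature/Analysis/FluidPDE`; namespace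
`Literature.Analysis.FluidPDE.BuckmasterCaolaboraGomezserrano2025.Monatomic.SonicSeries`. Companion
of `CompressibleEulerImplosion.lean` (named fact `BuckmasterCaolaboraGomezserrano2025_thm11_monatomic`,
THEOREM 1.1 of T. Buckmaster, G. Cao-Labora, J. Gómez-Serrano, *Smooth imploding solutions for 3D
compressible fluids*, Forum Math. Pi 13 (2025) e6, arXiv:2208.09445, at `γ = 5/3`, `α = 1/3`)
and of `CompressibleEulerImplosionMonatomicAlgebra.lean` (Brick B: the autonomous system (1.8)
`DW`, `DZ`, `NW`, `NZ`, the sonic point `P_s = (W0 r, Z0 r)`, the slopes `W1 r`, `Z1 r` of the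
direction `ν₋`, `k r`, `r3`, `r4`). Brick C1 of the discharge plan — §2.2, Propositions 2.2 and
2.3 ("Taylor expansion around `P_s`"): the coefficient recursion for the smooth solution
`(W^{(r)}, Z^{(r)})` of (1.8) through `P_s` tangent to `ν₋`, in ORDINARY Taylor coefficients
`wₙ = Wₙ/n!`, `zₙ = Zₙ/n!` (as in the proof of Prop. 2.3):

* order `n` of `D_W W′ = N_W` determines `w_{n+1}` (coefficient `D_W(P_s)(n+1) ≠ 0`,
  Lemma "aux_DW0") — (2.9);
* order `n` of `D_Z Z′ = N_Z` has leading coefficient `D_Z(P_s) = 0`; at order `n ≥ 2` the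
  coefficient of `zₙ` is `D_{Z,1}(n − k)` (`≠ 0` for `r ∈ (r₃, r₄)`, where `3 < k < 4`), which
  determines `zₙ` once `wₙ` is known — (2.10); orders `0` and `1` are the identities
  `N_Z(P_s) = 0` and the slope quadratic (2.3) for `Z₁`.

This file (part 1) PROVES the algebra: the recursion (`w`, `z`, `w_succ_succ`, `z_succ_succ`),
the identity `slopeZ = D_{Z,1}(n − k)` (`slopeZ_eq`), and that the resulting formal power series
satisfy both equations of (1.8) coefficientwise (`EW_wz`, `EZfull_wz`). Real definitions with
bodies + theorems; no facts. The Catalan majorant (Prop. 2.3) and the summation of the series are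
the subject of the sequel. [cite: BuckmasterCaolaboraGomezserrano2025, §2.2, Prop. 2.2, Prop. 2.3, eqs. (2.9)–(2.12)]
-/

noncomputable section

open Finset Filter Topology

namespace Literature.Analysis.FluidPDE

namespace BuckmasterCaolaboraGomezserrano2025

namespace Monatomic

namespace SonicSeries

/-! ### Coefficient operations -/

/-- Cauchy product coefficient `(fg)ₙ = ∑_{k≤n} f_k g_{n−k}`. [folklore] -/
def cauchy (f g : ℕ → ℝ) (n : ℕ) : ℝ := ∑ k ∈ range (n + 1), f k * g (n - k)

/-- Taylor coefficients of `D_W(W,Z) = 1 + (2W + Z)/3` along `W = ∑ fₙξⁿ`, `Z = ∑ gₙξⁿ`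
(`D_{W,n} = ∇D_W·(Wₙ,Zₙ)`, eq. (2.10)). [cite: BuckmasterCaolaboraGomezserrano2025, eq. (2.10)] -/
def dWc (f g : ℕ → ℝ) (n : ℕ) : ℝ := (if n = 0 then 1 else 0) + (2 * f n + g n) / 3

/-- Taylor coefficients of `D_Z(W,Z) = 1 + (W + 2Z)/3`. [cite: BuckmasterCaolaboraGomezserrano2025, eq. (2.10)] -/
def dZc (f g : ℕ → ℝ) (n : ℕ) : ℝ := (if n = 0 then 1 else 0) + (f n + 2 * g n) / 3

/-- [folklore] -/
@[simp] theorem dWc_succ (f g : ℕ → ℝ) (n : ℕ) : dWc f g (n + 1) = (2 * f (n + 1) + g (n + 1)) / 3 := by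
  simp [dWc]

/-- [folklore] -/
@[simp] theorem dZc_succ (f g : ℕ → ℝ) (n : ℕ) : dZc f g (n + 1) = (f (n + 1) + 2 * g (n + 1)) / 3 := by
  simp [dZc]

/-- [folklore] -/
@[simp] theorem dWc_one (f g : ℕ → ℝ) : dWc f g 1 = (2 * f 1 + g 1) / 3 := by simp [dWc]

/-- [folklore] -/
@[simp] theorem dZc_one (f g : ℕ → ℝ) : dZc f g 1 = (f 1 + 2 * g 1) / 3 := by simp [dZc]

/-- Taylor coefficients of `N_W(W,Z) = −rW − (5/6)W² − (1/3)WZ + (1/6)Z²` (eq. (2.11)).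
[cite: BuckmasterCaolaboraGomezserrano2025, eq. (2.11)] -/
def nWc (r : ℝ) (f g : ℕ → ℝ) (n : ℕ) : ℝ :=
  -r * f n - 5 / 6 * cauchy f f n - 1 / 3 * cauchy f g n + 1 / 6 * cauchy g g n

/-- Taylor coefficients of `N_Z(W,Z) = −rZ − (1/3)WZ − (5/6)Z² + (1/6)W²` (eq. (2.11)).
[cite: BuckmasterCaolaboraGomezserrano2025, eq. (2.11)] -/
def nZc (r : ℝ) (f g : ℕ → ℝ) (n : ℕ) : ℝ :=
  -r * g n - 1 / 3 * cauchy f g n - 5 / 6 * cauchy g g n + 1 / 6 * cauchy f f n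

/-- Order-`n` coefficient of `D_W(W,Z) W′ − N_W(W,Z)`. [cite: BuckmasterCaolaboraGomezserrano2025, Prop. 2.2] -/
def EW (r : ℝ) (f g : ℕ → ℝ) (n : ℕ) : ℝ :=
  ∑ k ∈ range (n + 1), dWc f g k * (((n - k : ℕ) : ℝ) + 1) * f (n - k + 1) - nWc r f g n

/-- Order-`n` coefficient of `D_Z(W,Z) Z′ − N_Z(W,Z)`. [cite: BuckmasterCaolaboraGomezserrano2025, Prop. 2.2] -/
def EZfull (r : ℝ) (f g : ℕ → ℝ) (n : ℕ) : ℝ :=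
  ∑ k ∈ range (n + 1), dZc f g k * (((n - k : ℕ) : ℝ) + 1) * g (n - k + 1) - nZc r f g n

/-- `EZfull` without its `k = 0` term `D_Z(W₀,Z₀)(n+1) z_{n+1}` (which vanishes at `P_s`).
[cite: BuckmasterCaolaboraGomezserrano2025, Prop. 2.2] -/
def EZ (r : ℝ) (f g : ℕ → ℝ) (n : ℕ) : ℝ :=
  ∑ k ∈ range n, dZc f g (k + 1) * (((n - (k + 1) : ℕ) : ℝ) + 1) * g (n - (k + 1) + 1)
    - nZc r f g n

/-- [cite: BuckmasterCaolaboraGomezserrano2025, Prop. 2.2] -/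
theorem EZfull_eq (r : ℝ) (f g : ℕ → ℝ) (n : ℕ) :
    EZfull r f g n = dZc f g 0 * ((n : ℝ) + 1) * g (n + 1) + EZ r f g n := by
  unfold EZfull EZ
  rw [sum_range_succ' (fun k => dZc f g k * (((n - k : ℕ) : ℝ) + 1) * g (n - k + 1))]
  simp only [Nat.sub_zero]
  ring

/-! ### The `W`-recursion (2.9): order `n` of `D_W W′ = N_W` determines `w_{n+1}` -/

/-- `EW` minus its `k = 0` term. [cite: BuckmasterCaolaboraGomezserrano2025, eq. (2.9)] -/
def restW (r : ℝ) (f g : ℕ → ℝ) (n : ℕ) : ℝ :=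
  ∑ k ∈ range n, dWc f g (k + 1) * (((n - (k + 1) : ℕ) : ℝ) + 1) * f (n - (k + 1) + 1)
    - nWc r f g n

/-- [cite: BuckmasterCaolaboraGomezserrano2025, eq. (2.9)] -/
theorem EW_eq (r : ℝ) (f g : ℕ → ℝ) (n : ℕ) :
    EW r f g n = dWc f g 0 * ((n : ℝ) + 1) * f (n + 1) + restW r f g n := by
  unfold EW restW
  rw [sum_range_succ' (fun k => dWc f g k * (((n - k : ℕ) : ℝ) + 1) * f (n - k + 1))]
  simp only [Nat.sub_zero]
  ring

/-- The forced value of `w_{n+1}` (eq. (2.9) solved for `W_{n+1}`). [cite: BuckmasterCaolaboraGomezserrano2025, eq. (2.9)] -/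
def nextW (r : ℝ) (f g : ℕ → ℝ) (n : ℕ) : ℝ := -restW r f g n / (dWc f g 0 * ((n : ℝ) + 1))

/-! ### The `Z`-recursion (2.10): order `n+2` of `D_Z Z′ = N_Z` determines `z_{n+2}` -/

/-- The coefficient of `zₘ` in `EZ` at order `m ≥ 2`:
`m D_{Z,1} + Z₁ ∂_Z D_Z(P_s) − ∂_Z N_Z(P_s)` (`= D_{Z,1}(m − k)`, eq. (2.10)). [cite: BuckmasterCaolaboraGomezserrano2025, eq. (2.10)] -/
def slopeZ (r : ℝ) (f g : ℕ → ℝ) (m : ℕ) : ℝ := dZc f g 1 * (m : ℝ) + 2 / 3 * g 1 - NZ_Z r (f 0) (g 0)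

/-- The coefficient of `wₘ` in `EZ` at order `m ≥ 2`: `Z₁ ∂_W D_Z(P_s) − ∂_W N_Z(P_s)`
(the term `Z₁ Wₘ ∂_W D_Z(P_s)` of (2.10)). [cite: BuckmasterCaolaboraGomezserrano2025, eq. (2.10)] -/
def coefW (f g : ℕ → ℝ) : ℝ := g 1 / 3 - NZ_W (f 0) (g 0)

/-- The remaining terms of `EZ` at order `n + 2` (indices in `[1, n+1]` only).
[cite: BuckmasterCaolaboraGomezserrano2025, eq. (2.10)] -/
def restZ (f g : ℕ → ℝ) (n : ℕ) : ℝ :=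
  ∑ k ∈ range n, dZc f g (k + 2) * (((n - k : ℕ) : ℝ) + 1) * g (n - k + 1)
    + 1 / 3 * ∑ k ∈ range (n + 1), f (k + 1) * g (n + 1 - k)
    + 5 / 6 * ∑ k ∈ range (n + 1), g (k + 1) * g (n + 1 - k)
    - 1 / 6 * ∑ k ∈ range (n + 1), f (k + 1) * f (n + 1 - k)

/-- Peeling the extreme terms of a Cauchy coefficient of order `n + 2`. [folklore] -/
theorem cauchy_succ_succ (f g : ℕ → ℝ) (n : ℕ) :
    cauchy f g (n + 2) = f 0 * g (n + 2) + ∑ k ∈ range (n + 1), f (k + 1) * g (n + 1 - k)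
      + f (n + 2) * g 0 := by
  unfold cauchy
  rw [sum_range_succ, sum_range_succ' (fun k => f k * g (n + 2 - k))]
  have h1 : ∀ k ∈ range (n + 1), f (k + 1) * g (n + 2 - (k + 1)) = f (k + 1) * g (n + 1 - k) := by
    intro k hk
    congr 2
    omega
  rw [sum_congr rfl h1]
  simp only [Nat.sub_zero, Nat.sub_self]
  ring

/-- **(2.10) at order `n + 2`.** [cite: BuckmasterCaolaboraGomezserrano2025, eq. (2.10)] -/
theorem EZ_eq_two (r : ℝ) (f g : ℕ → ℝ) (n : ℕ) :
    EZ r f g (n + 2) = slopeZ r f g (n + 2) * g (n + 2) + coefW f g * f (n + 2) + restZ f g n := by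
  unfold EZ restZ slopeZ coefW nZc NZ_Z NZ_W
  rw [dZc_one]
  rw [sum_range_succ, sum_range_succ' (fun k => dZc f g (k + 1) *
    (((n + 2 - (k + 1) : ℕ) : ℝ) + 1) * g (n + 2 - (k + 1) + 1))]
  have h1 : ∀ k ∈ range n, dZc f g (k + 1 + 1) * (((n + 2 - (k + 1 + 1) : ℕ) : ℝ) + 1)
      * g (n + 2 - (k + 1 + 1) + 1) = dZc f g (k + 2) * (((n - k : ℕ) : ℝ) + 1) * g (n - k + 1) := by
    intro k hk
    rw [mem_range] at hk
    have e1 : n + 2 - (k + 1 + 1) = n - k := by omega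
    rw [e1]
  rw [sum_congr rfl h1, cauchy_succ_succ f g n, cauchy_succ_succ g g n, cauchy_succ_succ f f n]
  have e3 : n + 2 - (0 + 1) = n + 1 := by omega
  have e5 : n + 2 - (n + 1 + 1) = 0 := by omega
  rw [e3, e5]
  simp only [dZc_succ, zero_add, Nat.cast_zero]
  push_cast
  ring

/-- The forced value of `z_{n+2}` given `w_{n+2}` (eq. (2.10) solved for `Z_{n+2}`).
[cite: BuckmasterCaolaboraGomezserrano2025, eq. (2.10)] -/
def nextZ (r : ℝ) (f g : ℕ → ℝ) (n : ℕ) (wnew : ℝ) : ℝ :=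
  -(coefW f g * wnew + restZ f g n) / slopeZ r f g (n + 2)

/-! ### The coefficient sequences -/

/-- Prefixes of the coefficient sequence `(wᵢ, zᵢ)` (plain structural recursion): `pre r n` is
correct up to index `n + 1`. [folklore] -/
def pre (r : ℝ) : ℕ → ℕ → ℝ × ℝ
  | 0 => fun i => if i = 0 then (W0 r, Z0 r) else if i = 1 then (W1 r, Z1 r) else 0
  | n + 1 => fun i => if i ≤ n + 1 then pre r n i else
      (nextW r (fun j => (pre r n j).1) (fun j => (pre r n j).2) (n + 1),
        nextZ r (fun j => (pre r n j).1) (fun j => (pre r n j).2) n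
          (nextW r (fun j => (pre r n j).1) (fun j => (pre r n j).2) (n + 1)))

/-- The pair `(wᵢ, zᵢ)`. [cite: BuckmasterCaolaboraGomezserrano2025, Prop. 2.2] -/
def coef (r : ℝ) (i : ℕ) : ℝ × ℝ := pre r i i

/-- **The ordinary Taylor coefficients `wₙ = Wₙ/n!` of `W^{(r)}` at `P_s`.**
[cite: BuckmasterCaolaboraGomezserrano2025, Prop. 2.2, eq. (2.12)] -/
def w (r : ℝ) (i : ℕ) : ℝ := (coef r i).1

/-- **The ordinary Taylor coefficients `zₙ = Zₙ/n!` of `Z^{(r)}` at `P_s`.**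
[cite: BuckmasterCaolaboraGomezserrano2025, Prop. 2.2, eq. (2.12)] -/
def z (r : ℝ) (i : ℕ) : ℝ := (coef r i).2

variable {r : ℝ}

/-- [cite: BuckmasterCaolaboraGomezserrano2025, Prop. 2.2] -/
@[simp] theorem w_zero : w r 0 = W0 r := by simp [w, coef, pre]

/-- [cite: BuckmasterCaolaboraGomezserrano2025, Prop. 2.2] -/
@[simp] theorem z_zero : z r 0 = Z0 r := by simp [z, coef, pre]

/-- [cite: BuckmasterCaolaboraGomezserrano2025, Prop. 2.2] -/
@[simp] theorem w_one : w r 1 = W1 r := by simp [w, coef, pre]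

/-- [cite: BuckmasterCaolaboraGomezserrano2025, Prop. 2.2] -/
@[simp] theorem z_one : z r 1 = Z1 r := by simp [z, coef, pre]

/-- [folklore] -/
theorem pre_eq_coef : ∀ n i : ℕ, i ≤ n + 1 → pre r n i = coef r i
  | 0, i, hi => by
    rcases Nat.le_one_iff_eq_zero_or_eq_one.mp hi with rfl | rfl
    · rfl
    · simp [coef, pre]
  | n + 1, i, hi => by
    by_cases h : i ≤ n + 1
    · simp only [pre, if_pos h]
      exact pre_eq_coef n i h
    · obtain rfl : i = n + 2 := by omega
      simp only [coef, pre, le_refl, if_true]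

/-- Congruence: `cauchy` depends on indices `≤ n`. [folklore] -/
theorem cauchy_congr {f f' g g' : ℕ → ℝ} {n : ℕ} (hf : ∀ i ≤ n, f i = f' i)
    (hg : ∀ i ≤ n, g i = g' i) : cauchy f g n = cauchy f' g' n := by
  unfold cauchy
  refine sum_congr rfl fun k hk => ?_
  rw [mem_range] at hk
  rw [hf k (by omega), hg (n - k) (by omega)]

/-- Congruence: `restW r f g n` depends on indices `≤ n`. [folklore] -/
theorem restW_congr {f f' g g' : ℕ → ℝ} {n : ℕ} (hf : ∀ i ≤ n, f i = f' i)
    (hg : ∀ i ≤ n, g i = g' i) : restW r f g n = restW r f' g' n := by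
  unfold restW nWc
  have h1 : ∀ k ∈ range n, dWc f g (k + 1) * (((n - (k + 1) : ℕ) : ℝ) + 1) * f (n - (k + 1) + 1)
      = dWc f' g' (k + 1) * (((n - (k + 1) : ℕ) : ℝ) + 1) * f' (n - (k + 1) + 1) := by
    intro k hk
    rw [mem_range] at hk
    unfold dWc
    rw [hf (k + 1) (by omega), hg (k + 1) (by omega), hf (n - (k + 1) + 1) (by omega)]
  rw [sum_congr rfl h1, cauchy_congr hf hf, cauchy_congr hf hg, cauchy_congr hg hg, hf n le_rfl]

/-- Congruence: `restZ f g n` depends on indices `≤ n + 1`. [folklore] -/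
theorem restZ_congr {f f' g g' : ℕ → ℝ} {n : ℕ} (hf : ∀ i ≤ n + 1, f i = f' i)
    (hg : ∀ i ≤ n + 1, g i = g' i) : restZ f g n = restZ f' g' n := by
  unfold restZ
  have h1 : ∀ k ∈ range n, dZc f g (k + 2) * (((n - k : ℕ) : ℝ) + 1) * g (n - k + 1)
      = dZc f' g' (k + 2) * (((n - k : ℕ) : ℝ) + 1) * g' (n - k + 1) := by
    intro k hk
    rw [mem_range] at hk
    unfold dZc
    rw [hf (k + 2) (by omega), hg (k + 2) (by omega), hg (n - k + 1) (by omega)]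
  have h2 : ∀ k ∈ range (n + 1), f (k + 1) * g (n + 1 - k) = f' (k + 1) * g' (n + 1 - k) := by
    intro k hk; rw [mem_range] at hk; rw [hf (k + 1) (by omega), hg (n + 1 - k) (by omega)]
  have h3 : ∀ k ∈ range (n + 1), g (k + 1) * g (n + 1 - k) = g' (k + 1) * g' (n + 1 - k) := by
    intro k hk; rw [mem_range] at hk; rw [hg (k + 1) (by omega), hg (n + 1 - k) (by omega)]
  have h4 : ∀ k ∈ range (n + 1), f (k + 1) * f (n + 1 - k) = f' (k + 1) * f' (n + 1 - k) := by
    intro k hk; rw [mem_range] at hk; rw [hf (k + 1) (by omega), hf (n + 1 - k) (by omega)]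
  rw [sum_congr rfl h1, sum_congr rfl h2, sum_congr rfl h3, sum_congr rfl h4]

/-- **The recursion for `w`**: `w_{n+2} = nextW(w, z)(n+1)` (eq. (2.9)). [cite: BuckmasterCaolaboraGomezserrano2025, eq. (2.9)] -/
theorem w_succ_succ (n : ℕ) : w r (n + 2) = nextW r (w r) (z r) (n + 1) := by
  have hf : ∀ i ≤ n + 1, (pre r n i).1 = w r i := fun i hi => by
    show (pre r n i).1 = (coef r i).1; rw [pre_eq_coef n i hi]
  have hg : ∀ i ≤ n + 1, (pre r n i).2 = z r i := fun i hi => by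
    show (pre r n i).2 = (coef r i).2; rw [pre_eq_coef n i hi]
  show (pre r (n + 2) (n + 2)).1 = _
  simp only [pre, le_refl, if_true, show ¬ (n + 2 ≤ n + 1) from by omega, if_false]
  unfold nextW
  rw [restW_congr hf hg]
  unfold dWc
  beta_reduce
  rw [hf 0 (by omega), hg 0 (by omega)]

/-- **The recursion for `z`**: `z_{n+2} = nextZ(w, z)(n)(w_{n+2})` (eq. (2.10)). [cite: BuckmasterCaolaboraGomezserrano2025, eq. (2.10)] -/
theorem z_succ_succ (n : ℕ) : z r (n + 2) = nextZ r (w r) (z r) n (w r (n + 2)) := by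
  have hf : ∀ i ≤ n + 1, (pre r n i).1 = w r i := fun i hi => by
    show (pre r n i).1 = (coef r i).1; rw [pre_eq_coef n i hi]
  have hg : ∀ i ≤ n + 1, (pre r n i).2 = z r i := fun i hi => by
    show (pre r n i).2 = (coef r i).2; rw [pre_eq_coef n i hi]
  rw [w_succ_succ]
  show (pre r (n + 2) (n + 2)).2 = _
  simp only [pre, le_refl, if_true, show ¬ (n + 2 ≤ n + 1) from by omega, if_false]
  unfold nextZ nextW coefW slopeZ
  rw [restW_congr hf hg, restZ_congr hf hg]
  unfold dWc dZc
  beta_reduce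
  rw [hf 0 (by omega), hg 0 (by omega), hf 1 (by omega), hg 1 (by omega)]

/-! ### The formal identities: both equations of (1.8) hold coefficientwise -/

/-- `D_{W,0} = D_W(P_s)`. [cite: BuckmasterCaolaboraGomezserrano2025, Prop. 2.2] -/
theorem dWc_zero : dWc (w r) (z r) 0 = DW (W0 r) (Z0 r) := by
  simp [dWc, DW]

/-- `D_{Z,0} = D_Z(P_s) = 0`. [cite: BuckmasterCaolaboraGomezserrano2025, Prop. 2.2] -/
theorem dZc_zero : dZc (w r) (z r) 0 = 0 := by
  have h := DZ_Ps r
  unfold DZ at h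
  simp [dZc]
  linarith

/-- `N_{W,0} = N_W(P_s)`. [cite: BuckmasterCaolaboraGomezserrano2025, Prop. 2.2] -/
theorem nWc_zero : nWc r (w r) (z r) 0 = NW r (W0 r) (Z0 r) := by
  simp [nWc, cauchy, NW]; ring

/-- `N_{Z,0} = N_Z(P_s)`. [cite: BuckmasterCaolaboraGomezserrano2025, Prop. 2.2] -/
theorem nZc_zero : nZc r (w r) (z r) 0 = NZ r (W0 r) (Z0 r) := by
  simp [nZc, cauchy, NZ]; ring

/-- `slopeZ = D_{Z,1}(m − k)` with `D_{Z,1} = 2 − r − p`, `k = (2 − r + p)/(2 − r − p)`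
(Lemma 2.1 / eq. (2.9′)). [cite: BuckmasterCaolaboraGomezserrano2025, eq. (2.9), Lemma 2.1] -/
theorem slopeZ_eq (h : 2 - r - p r ≠ 0) (m : ℕ) :
    slopeZ r (w r) (z r) m = (2 - r - p r) * ((m : ℝ) - k r) := by
  unfold slopeZ
  rw [dZc_one, w_zero, z_zero, w_one, z_one, NZ_Z_Ps]
  unfold k W1 Z1
  field_simp
  ring

/-- `slopeZ ≠ 0` for `r ∈ (r₃, r₄)` (there `3 < k < 4`, so `m − k ≠ 0` for every integer `m`).
[cite: BuckmasterCaolaboraGomezserrano2025, Prop. 2.2] -/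
theorem slopeZ_ne (h3 : r3 < r) (h4 : r < r4) (m : ℕ) : slopeZ r (w r) (z r) m ≠ 0 := by
  have hm := r3_r4_mem
  have hr : r < rstar := h4.trans hm.2.2
  have hD := DZ1_pos hr
  rw [slopeZ_eq hD.ne']
  refine mul_ne_zero hD.ne' ?_
  have hk := k_mem_Ioo h3 h4
  intro hmk
  have : (m : ℝ) = k r := by linarith
  rcases Nat.lt_or_ge m 4 with hlt | hge
  · have : (m : ℝ) ≤ 3 := by exact_mod_cast Nat.lt_succ_iff.mp hlt
    linarith [hk.1]
  · have : (4 : ℝ) ≤ m := by exact_mod_cast hge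
    linarith [hk.2]

/-- `D_{W,0} ≠ 0` for `r < 2`. [cite: BuckmasterCaolaboraGomezserrano2025, Prop. 2.2 (Lemma "aux_DW0")] -/
theorem dWc_zero_ne (hr : r < 2) : dWc (w r) (z r) 0 ≠ 0 := by
  rw [dWc_zero]; exact (DW_Ps_pos hr).ne'

/-- **Equation `W` holds at every order**: the order-`n` coefficient of `D_W W′ − N_W` vanishes
(order `0` is (2.2) `W₁ = N_W(P_s)/D_W(P_s)`, orders `n ≥ 1` are the recursion (2.9)).
[cite: BuckmasterCaolaboraGomezserrano2025, Prop. 2.2, eqs. (2.2), (2.9)] -/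
theorem EW_wz (hr : r < rstar) (n : ℕ) : EW r (w r) (z r) n = 0 := by
  have hr2 : r < 2 := by linarith [rstar_lt]
  rcases n with _ | n
  · -- order 0 : `D_W(P_s) W₁ = N_W(P_s)`
    rw [EW_eq]
    unfold restW
    rw [sum_range_zero, dWc_zero, nWc_zero, w_one, W1_eq hr]
    have := (DW_Ps_pos hr2).ne'
    field_simp
    ring
  · rw [EW_eq, w_succ_succ]
    unfold nextW
    have := dWc_zero_ne (r := r) hr2
    have hn : ((n + 1 : ℕ) : ℝ) + 1 ≠ 0 := by positivity
    field_simp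
    ring

/-- **Equation `Z` holds at every order**: the order-`n` coefficient of `D_Z Z′ − N_Z` vanishes
(order `0` is `N_Z(P_s) = 0`, order `1` is the slope quadratic (2.3) for `Z₁`, orders `n ≥ 2`
are the recursion (2.10) with denominators `D_{Z,1}(n − k) ≠ 0`, `r ∈ (r₃, r₄)`).
[cite: BuckmasterCaolaboraGomezserrano2025, Prop. 2.2, eqs. (2.3), (2.10)] -/
theorem EZfull_wz (h3 : r3 < r) (h4 : r < r4) (n : ℕ) : EZfull r (w r) (z r) n = 0 := by
  have hm := r3_r4_mem
  have hr : r < rstar := h4.trans hm.2.2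
  have h1r : 1 ≤ r := (hm.1.trans h3).le
  have hdisc : 0 ≤ disc r := (disc_pos hr).le
  rw [EZfull_eq, dZc_zero, zero_mul, zero_mul, zero_add]
  rcases n with _ | n
  · -- order 0 : `N_Z(P_s) = 0`
    unfold EZ
    rw [sum_range_zero, nZc_zero, NZ_Ps hdisc]
    ring
  rcases n with _ | n
  · -- order 1 : the slope quadratic for `Z₁`
    have hq := slope_eq_Z1 h1r hdisc
    unfold NZ_W NZ_Z at hq
    unfold EZ nZc cauchy
    simp [sum_range_succ]
    linear_combination hq
  · -- order n + 2 : the recursion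
    rw [EZ_eq_two, z_succ_succ]
    unfold nextZ
    have := slopeZ_ne h3 h4 (n + 2)
    field_simp
    ring

end SonicSeries

end Monatomic

end BuckmasterCaolaboraGomezserrano2025

end Literature.Analysis.FluidPDE
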